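import Literature.Analysis.Calculus.PolarCoordinatesE3
import HarnessLib

/-!
# Crux `OneBodyEntropyBound` (stmt-AtomisticToContinuum-13440), line `registered`: stub `stub_jastrowProfile`

Route `BECCellInformation`, problem `BoseEinsteinCondensation` of the summit `AtomisticToContinuum`;
support file for the line's skeleton (namespace `…Cruxes.OneBodyEntropyBound.Birth`).

**Statement** (`stub_jastrowProfile`, the one-body JASTROW PROFILE of the Dyson insertion): for
every `R₁ > 0` there is a `C¹` function `f : ℝ³ → [0, 1]` vanishing on the closed ball of radius
`R₁`, even, whose gradient is dominated by its own deficiency, `‖Df(z)‖ ≤ 1 - f(z)`, and with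
`1 - f` integrable on `ℝ³`.

**Proof.** Take `f(z) = 1 - (1 + t) e^{-t}` with `t = (‖z‖ - R₁)₊ = max (‖z‖ - R₁) 0`. The radial
profile `P(r) = 1 - (1 + (r - R₁)₊) e^{-(r - R₁)₊}` is `C¹` on `ℝ`: it is `0` on `r < R₁`, smooth
on `r > R₁` with `P'(r) = (r - R₁) e^{-(r - R₁)}`, and both one-sided derivatives vanish at
`r = R₁` (`hasDerivAt_of_hasDerivAt_of_ne`); so `P'(r) = (r - R₁)₊ e^{-(r - R₁)₊} ≤ 1 - P(r)`.
The norm is smooth away from the origin with `‖D‖·‖‖ ≤ 1` (`1`-Lipschitz), and `f ≡ 0` near the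
origin, whence `f = P ∘ ‖·‖` is `C¹` with `‖Df(z)‖ ≤ P'(‖z‖) ≤ 1 - f(z)`; `0 ≤ f ≤ 1` is
`1 + t ≤ e^t`. Finally `1 - f(z) ≤ e^{R₁} (1 + ‖z‖) e^{-‖z‖}`, so in polar coordinates
(`Literature.Analysis.Calculus.lintegral_radial_eq`)
`∫ (1 - f) ≤ σ(S²) e^{R₁} ∫_0^∞ (r² + r³) e^{-r} dr = σ(S²) e^{R₁} (Γ(3) + Γ(4)) < ∞`
(`Real.GammaIntegral_convergent`).
-/

noncomputable section

namespace Summit.AtomisticToContinuum.BoseEinsteinCondensation.Cruxes.OneBodyEntropyBound.Birth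

open MeasureTheory Set Filter Real
open scoped ENNReal NNReal Topology

namespace JastrowProfile

/-- The scalar profile `(1 + t) e^{-t}` lies in `(0, 1]` for `t ≥ 0` (`1 + t ≤ e^t`). [folklore] -/
theorem profile_pos_le_one {t : ℝ} (ht : 0 ≤ t) :
    0 < (1 + t) * Real.exp (-t) ∧ (1 + t) * Real.exp (-t) ≤ 1 := by
  refine ⟨by positivity, ?_⟩
  have h1 : 1 + t ≤ Real.exp t := by linarith [Real.add_one_le_exp t]
  calc (1 + t) * Real.exp (-t) ≤ Real.exp t * Real.exp (-t) := by gcongr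
    _ = 1 := by rw [← Real.exp_add, add_neg_cancel, Real.exp_zero]

/-- The radial profile `P(r) = 1 - (1 + (r-R)₊) e^{-(r-R)₊}` has derivative `(r-R)₊ e^{-(r-R)₊}`
at every `r` (it is `0` left of `R`, smooth right of `R`, and both one-sided derivatives vanish at
`r = R`). [folklore] -/
theorem hasDerivAt_radialProfile (R r : ℝ) :
    HasDerivAt (fun r => 1 - (1 + max (r - R) 0) * Real.exp (-max (r - R) 0))
      (max (r - R) 0 * Real.exp (-max (r - R) 0)) r := by
  -- away from `r = R`
  have hne : ∀ y ≠ R, HasDerivAt (fun r => 1 - (1 + max (r - R) 0) * Real.exp (-max (r - R) 0))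
      (max (y - R) 0 * Real.exp (-max (y - R) 0)) y := by
    intro y hy
    rcases lt_or_gt_of_ne hy with hlt | hgt
    · -- locally zero left of `R`
      have hev : (fun r => 1 - (1 + max (r - R) 0) * Real.exp (-max (r - R) 0)) =ᶠ[𝓝 y]
          fun _ => (0 : ℝ) := by
        filter_upwards [Iio_mem_nhds hlt] with r hr
        rw [max_eq_right (sub_nonpos.2 (mem_Iio.1 hr).le)]
        simp
      rw [max_eq_right (sub_nonpos.2 hlt.le), zero_mul]
      exact (hasDerivAt_const y (0 : ℝ)).congr_of_eventuallyEq hev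
    · -- locally the smooth formula right of `R`
      have hev : (fun r => 1 - (1 + max (r - R) 0) * Real.exp (-max (r - R) 0)) =ᶠ[𝓝 y]
          fun r => 1 - (1 + (r - R)) * Real.exp (-(r - R)) := by
        filter_upwards [Ioi_mem_nhds hgt] with r hr
        rw [max_eq_left (sub_nonneg.2 (mem_Ioi.1 hr).le)]
      rw [max_eq_left (sub_nonneg.2 hgt.le)]
      have h1 : HasDerivAt (fun r : ℝ => r - R) 1 y := (hasDerivAt_id y).sub_const R
      have h2 := ((h1.const_add 1).fun_mul h1.fun_neg.exp).const_sub 1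
      refine (h2.congr_of_eventuallyEq hev).congr_deriv ?_
      ring
  rcases eq_or_ne r R with h | h
  · subst h
    refine hasDerivAt_of_hasDerivAt_of_ne hne ?_ ?_
    · exact Continuous.continuousAt (by fun_prop)
    · exact Continuous.continuousAt (by fun_prop)
  · exact hne r h

/-- The radial profile `P(r) = 1 - (1 + (r-R)₊) e^{-(r-R)₊}` is `C¹`. [folklore] -/
theorem contDiff_radialProfile (R : ℝ) :
    ContDiff ℝ 1 (fun r => 1 - (1 + max (r - R) 0) * Real.exp (-max (r - R) 0)) := by
  refine contDiff_one_iff_deriv.2 ⟨fun r => (hasDerivAt_radialProfile R r).differentiableAt, ?_⟩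
  rw [deriv_eq (hasDerivAt_radialProfile R)]
  fun_prop

/-- `f(z) = P(‖z‖)` vanishes on the closed ball of radius `R`. [folklore] -/
theorem radial_eq_zero {R : ℝ} {z : EuclideanSpace ℝ (Fin 3)} (hz : ‖z‖ ≤ R) :
    1 - (1 + max (‖z‖ - R) 0) * Real.exp (-max (‖z‖ - R) 0) = 0 := by
  rw [max_eq_right (sub_nonpos.2 hz)]
  simp

/-- `f(z) = P(‖z‖)` is `C¹` on `ℝ³` for `R > 0` (locally zero near the origin, and the norm is
smooth away from it). [folklore] -/
theorem contDiff_radial {R : ℝ} (hR : 0 < R) :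
    ContDiff ℝ 1 (fun z : EuclideanSpace ℝ (Fin 3) =>
      1 - (1 + max (‖z‖ - R) 0) * Real.exp (-max (‖z‖ - R) 0)) := by
  refine contDiff_iff_contDiffAt.2 fun z => ?_
  by_cases hz : z = 0
  · subst hz
    have hev : (fun z : EuclideanSpace ℝ (Fin 3) =>
        1 - (1 + max (‖z‖ - R) 0) * Real.exp (-max (‖z‖ - R) 0)) =ᶠ[𝓝 0] fun _ => (0 : ℝ) := by
      filter_upwards [Metric.ball_mem_nhds (0 : EuclideanSpace ℝ (Fin 3)) hR] with w hw
      exact radial_eq_zero (mem_ball_zero_iff.1 hw).le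
    exact (contDiffAt_const (c := (0 : ℝ))).congr_of_eventuallyEq hev
  · exact (contDiff_radialProfile R).contDiffAt.comp z (contDiffAt_norm ℝ hz)

/-- Gradient bound `‖Df(z)‖ ≤ P'(‖z‖) = (‖z‖-R)₊ e^{-(‖z‖-R)₊}` (chain rule; the norm is
`1`-Lipschitz). [folklore] -/
theorem norm_fderiv_radial_le {R : ℝ} (hR : 0 < R) (z : EuclideanSpace ℝ (Fin 3)) :
    ‖fderiv ℝ (fun z : EuclideanSpace ℝ (Fin 3) =>
        1 - (1 + max (‖z‖ - R) 0) * Real.exp (-max (‖z‖ - R) 0)) z‖ ≤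
      max (‖z‖ - R) 0 * Real.exp (-max (‖z‖ - R) 0) := by
  by_cases hz : z = 0
  · subst hz
    have hev : (fun z : EuclideanSpace ℝ (Fin 3) =>
        1 - (1 + max (‖z‖ - R) 0) * Real.exp (-max (‖z‖ - R) 0)) =ᶠ[𝓝 0] fun _ => (0 : ℝ) := by
      filter_upwards [Metric.ball_mem_nhds (0 : EuclideanSpace ℝ (Fin 3)) hR] with w hw
      exact radial_eq_zero (mem_ball_zero_iff.1 hw).le
    rw [hev.fderiv_eq, fderiv_const_apply, norm_zero]
    positivity
  · set Ln : EuclideanSpace ℝ (Fin 3) →L[ℝ] ℝ := fderiv ℝ (norm : EuclideanSpace ℝ (Fin 3) → ℝ) z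
      with hLn'
    have hLn : ‖Ln‖ ≤ 1 := by
      have h := norm_fderiv_le_of_lipschitz ℝ (f := (norm : EuclideanSpace ℝ (Fin 3) → ℝ))
        (x₀ := z) lipschitzWith_one_norm
      simpa using h
    have hn : HasFDerivAt (norm : EuclideanSpace ℝ (Fin 3) → ℝ) Ln z :=
      ((contDiffAt_norm ℝ hz (n := 1)).differentiableAt one_ne_zero).hasFDerivAt
    have hf : HasFDerivAt (fun z : EuclideanSpace ℝ (Fin 3) =>
        1 - (1 + max (‖z‖ - R) 0) * Real.exp (-max (‖z‖ - R) 0))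
        ((max (‖z‖ - R) 0 * Real.exp (-max (‖z‖ - R) 0)) • Ln) z :=
      (hasDerivAt_radialProfile R ‖z‖).comp_hasFDerivAt z hn
    rw [hf.fderiv, norm_smul, Real.norm_eq_abs, abs_of_nonneg (by positivity)]
    calc max (‖z‖ - R) 0 * Real.exp (-max (‖z‖ - R) 0) * ‖Ln‖
        ≤ max (‖z‖ - R) 0 * Real.exp (-max (‖z‖ - R) 0) * 1 := by gcongr
      _ = _ := mul_one _

/-- Exponential tail: `(1 + (r-R)₊) e^{-(r-R)₊} ≤ e^R (1 + r) e^{-r}` for `r, R ≥ 0`. [folklore] -/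
theorem profile_le_exp {R r : ℝ} (hR : 0 ≤ R) (hr : 0 ≤ r) :
    (1 + max (r - R) 0) * Real.exp (-max (r - R) 0) ≤ Real.exp R * ((1 + r) * Real.exp (-r)) := by
  have hkey : Real.exp R * ((1 + r) * Real.exp (-r)) = (1 + r) * Real.exp (R - r) := by
    rw [sub_eq_add_neg, Real.exp_add]; ring
  rw [hkey]
  rcases le_total r R with h | h
  · rw [max_eq_right (sub_nonpos.2 h), neg_zero, Real.exp_zero, mul_one, add_zero]
    exact one_le_mul_of_one_le_of_one_le (by linarith) (Real.one_le_exp (sub_nonneg.2 h))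
  · rw [max_eq_left (sub_nonneg.2 h), show -(r - R) = R - r by ring]
    gcongr
    linarith

/-- Integrability of the deficiency: `∫_{ℝ³} (1 + (‖z‖-R)₊) e^{-(‖z‖-R)₊} dz < ∞` (polar
coordinates and the Gamma integrals `Γ(3)`, `Γ(4)`). [folklore] -/
theorem lintegral_radial_ne_top {R : ℝ} (hR : 0 < R) :
    (∫⁻ z : EuclideanSpace ℝ (Fin 3), ENNReal.ofReal
      (1 - (1 - (1 + max (‖z‖ - R) 0) * Real.exp (-max (‖z‖ - R) 0)))) ≠ ⊤ := by
  simp_rw [sub_sub_cancel]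
  have hmeas : Measurable fun r : ℝ =>
      ENNReal.ofReal ((1 + max (r - R) 0) * Real.exp (-max (r - R) 0)) :=
    (by fun_prop : Continuous fun r : ℝ =>
      (1 + max (r - R) 0) * Real.exp (-max (r - R) 0)).measurable.ennreal_ofReal
  rw [Literature.Analysis.Calculus.lintegral_radial_eq
    (fun r => ENNReal.ofReal ((1 + max (r - R) 0) * Real.exp (-max (r - R) 0))) hmeas]
  refine ENNReal.mul_ne_top (measure_ne_top _ _) (ne_of_lt ?_)
  have hint : IntegrableOn (fun r : ℝ => Real.exp R *
      (Real.exp (-r) * r ^ ((3 : ℝ) - 1) + Real.exp (-r) * r ^ ((4 : ℝ) - 1))) (Ioi 0) :=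
    ((Real.GammaIntegral_convergent (by norm_num : (0 : ℝ) < 3)).add
      (Real.GammaIntegral_convergent (by norm_num : (0 : ℝ) < 4))).const_mul (Real.exp R)
  refine lt_of_le_of_lt (setLIntegral_mono' measurableSet_Ioi fun r hr => ?_) hint.lintegral_lt_top
  have hr0 : 0 < r := hr
  have h3 : r ^ ((3 : ℝ) - 1) = r ^ 2 := by
    rw [show (3 : ℝ) - 1 = ((2 : ℕ) : ℝ) by norm_num, Real.rpow_natCast]
  have h4 : r ^ ((4 : ℝ) - 1) = r ^ 3 := by
    rw [show (4 : ℝ) - 1 = ((3 : ℕ) : ℝ) by norm_num, Real.rpow_natCast]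
  rw [h3, h4, ← ENNReal.ofReal_mul (profile_pos_le_one (le_max_right _ _)).1.le]
  refine ENNReal.ofReal_le_ofReal ?_
  calc (1 + max (r - R) 0) * Real.exp (-max (r - R) 0) * r ^ 2
      ≤ Real.exp R * ((1 + r) * Real.exp (-r)) * r ^ 2 :=
        mul_le_mul_of_nonneg_right (profile_le_exp hR.le hr0.le) (by positivity)
    _ = Real.exp R * (Real.exp (-r) * r ^ 2 + Real.exp (-r) * r ^ 3) := by ring

end JastrowProfile

open JastrowProfile in
/-- **The one-body Jastrow profile.** For every `R₁ > 0` there is a `C¹` function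
`f : ℝ³ → [0, 1]`, vanishing on the closed ball of radius `R₁`, even, with `‖Df‖ ≤ 1 - f`
pointwise and `∫ (1 - f) < ∞`; explicitly `f(z) = 1 - (1 + t) e^{-t}`, `t = (‖z‖ - R₁)₊`.
[folklore] -/
theorem stub_jastrowProfile :
    ∀ R₁ : ℝ, 0 < R₁ → ∃ f : EuclideanSpace ℝ (Fin 3) → ℝ,
      ContDiff ℝ 1 f ∧ (∀ z, 0 ≤ f z ∧ f z ≤ 1) ∧ (∀ z, ‖z‖ ≤ R₁ → f z = 0) ∧
      (∀ z, ‖fderiv ℝ f z‖ ≤ 1 - f z) ∧ (∀ z, f (-z) = f z) ∧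
      (∫⁻ z, ENNReal.ofReal (1 - f z)) ≠ ⊤ := by
  intro R hR
  refine ⟨fun z => 1 - (1 + max (‖z‖ - R) 0) * Real.exp (-max (‖z‖ - R) 0),
    contDiff_radial hR, fun z => ?_, fun z hz => radial_eq_zero hz, fun z => ?_, fun z => ?_,
    lintegral_radial_ne_top hR⟩
  · have h := profile_pos_le_one (le_max_right (‖z‖ - R) 0)
    exact ⟨sub_nonneg.2 h.2, sub_le_self _ h.1.le⟩
  · refine (norm_fderiv_radial_le hR z).trans ?_
    dsimp only
    rw [sub_sub_cancel]
    exact mul_le_mul_of_nonneg_right (by linarith) (Real.exp_pos _).le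
  · simp only [norm_neg]

end Summit.AtomisticToContinuum.BoseEinsteinCondensation.Cruxes.OneBodyEntropyBound.Birth

end
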